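import Summits.RiemannHypothesis.RiemannHypothesis.Theorems.DBNKernelMasses
import Mathlib.MeasureTheory.Integral.IntegralEqImproper
import Mathlib.Analysis.SpecialFunctions.Trigonometric.ArctanDeriv
import Mathlib.Analysis.SpecialFunctions.Log.Deriv
import HarnessLib

/-!
# RiemannHypothesis / DBN — T10 `CauchySemigroup` and T11 `ProbeKernelFactorisation` (+ boundary form)

RH-FREE real analysis (column DBN of the RH ladder, D-0040 record-keeping at T₀; THEORY-R4 §2 of the
`pub-dbn` cell, `pub-dbn-theory/Sketch4.lean` sha16 3a8b9a024097398f, namespace `DbnTheory4`;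
support-grade targets, "nobody owes them").  Definitions `cauchy`, `smearedCauchy` and the three typed
statements are byte-verbatim from the sketch and PROVED here (sorry-free, standard axioms):

* T10 `CauchySemigroup`: `∫ cauchy a (x - y) · cauchy b y dy = π · cauchy (a+b) x` (`a, b > 0`) — the
  Poisson semigroup on the line.  Proof: explicit partial fractions + the fundamental theorem of calculus
  on `ℝ` (`MeasureTheory.integral_of_hasDerivAt_of_tendsto`) for `x ≠ 0`; the point `x = 0` by continuity
  of both sides in `x` (dominated convergence, bound `a⁻¹ · cauchy b`).
* T11 `ProbeKernelFactorisation`: for `c > 1`, `|η| < 1`,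
  `S_{c,κ,u}(·,η) = (1/2π) · smearedCauchy_{c,κ,u} ∗ P(·,η)` — Fubini on `ℝ × (-1,1]` and T10 with the
  semigroup heights `(c−1) + (1∓η) = c∓η`.
* T11 boundary form `ProbeKernelBoundaryFactorisation`: on the line `η = 1`, where the descent kernel's
  trace is `2π·δ₀ + 4/(ξ²+4)`, `S(·,1) = smearedCauchy + (1/2π) · smearedCauchy ∗ 4/(·²+4)`.

So every 1-D admissible signed kernel is a Poisson smoothing of the descent kernel (THEORY-R4 §2: "the
probe class is the cone of Poisson-smoothings of `P`").  SHARPENS the reading of T1a/T1c, LOWERS NOTHING;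
`--supports stmt-RiemannHypothesis-0274`; nothing here bears on the truth of RH.
-/

noncomputable section

-- D-0017: `Summit.<S>.<S>.…` is the designed namespace of a single-problem summit.
set_option linter.dupNamespace false

open scoped Real Topology
open MeasureTheory Set Filter

namespace Summit.RiemannHypothesis.RiemannHypothesis.Theorems.DbnTheory

/-- Poisson kernel of the upper half-plane at height `a`: `cauchy a x = a/(x²+a²)` (mass `π` for `a > 0`).
(verbatim `DbnTheory4.cauchy`, THEORY-R4 §2) -/
def cauchy (a x : ℝ) : ℝ := a / (x^2 + a^2)

/-- T10 (RH-FREE, support-grade) — Poisson semigroup on the line: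
`cauchy_a ∗ cauchy_b = π · cauchy_{a+b}`. (verbatim `DbnTheory4.CauchySemigroup`, THEORY-R4 §2) -/
def CauchySemigroup : Prop :=
  ∀ a b x : ℝ, 0 < a → 0 < b → ∫ y, cauchy a (x - y) * cauchy b y = π * cauchy (a + b) x

/-! ## Elementary facts about `cauchy` -/

/-- `0 ≤ cauchy a x` for `a > 0`. [folklore] -/
theorem cauchy_nonneg {a : ℝ} (ha : 0 < a) (x : ℝ) : 0 ≤ cauchy a x := by
  unfold cauchy; positivity

/-- `cauchy a x ≤ 1/a` for `a > 0`. [folklore] -/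
theorem cauchy_le_inv {a : ℝ} (ha : 0 < a) (x : ℝ) : cauchy a x ≤ a⁻¹ := by
  unfold cauchy
  rw [div_le_iff₀ (by positivity)]
  have h : a⁻¹ * (x^2 + a^2) = a + a⁻¹ * x^2 := by field_simp; ring
  rw [h]
  have : 0 ≤ a⁻¹ * x^2 := by positivity
  linarith

/-- `cauchy a` is continuous for `a > 0`. [folklore] -/
theorem continuous_cauchy {a : ℝ} (ha : 0 < a) : Continuous (cauchy a) := by
  unfold cauchy
  exact continuous_const.div (by fun_prop) fun x => by positivity

/-- `cauchy a` is integrable on `ℝ` (`a > 0`; mass `π` = `integral_poisson`). [folklore] -/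
theorem integrable_cauchy {a : ℝ} (ha : 0 < a) : Integrable (cauchy a) := integrable_poisson ha

/-- the convolution integrand `y ↦ cauchy a (x - y) · cauchy b y` is integrable (`a, b > 0`). [folklore] -/
theorem integrable_cauchy_conv {a b : ℝ} (ha : 0 < a) (hb : 0 < b) (x : ℝ) :
    Integrable fun y => cauchy a (x - y) * cauchy b y := by
  refine (integrable_cauchy hb).bdd_mul (c := a⁻¹)
    ((continuous_cauchy ha).comp (continuous_const.sub continuous_id)).aestronglyMeasurable
    (Eventually.of_forall fun y => ?_)
  rw [Real.norm_of_nonneg (cauchy_nonneg ha _)]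
  exact cauchy_le_inv ha _

/-! ## The antiderivative (partial fractions) and its limits -/

/-- antiderivative of `y ↦ cauchy a (x - y) · cauchy b y` (valid when `x ≠ 0` or `a ≠ b`). [folklore] -/
private def cauchyConvPrim (a b x y : ℝ) : ℝ :=
  a * b / ((x^2 + (a - b)^2) * (x^2 + (a + b)^2)) *
    (x * (Real.log (y^2 + b^2) - Real.log ((y - x)^2 + a^2))
      + (x^2 - a^2 + b^2) / a * Real.arctan ((y - x) / a)
      + (x^2 + a^2 - b^2) / b * Real.arctan (y / b))

/-- derivative of the antiderivative is the convolution integrand (`a, b > 0`, `x ≠ 0`). [folklore] -/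
private theorem hasDerivAt_cauchyConvPrim {a b x : ℝ} (ha : 0 < a) (hb : 0 < b) (hx : x ≠ 0) (y : ℝ) :
    HasDerivAt (cauchyConvPrim a b x) (cauchy a (x - y) * cauchy b y) y := by
  have hyb : y^2 + b^2 ≠ 0 := by positivity
  have hya : (y - x)^2 + a^2 ≠ 0 := by positivity
  have h_log1 : HasDerivAt (fun y => Real.log (y^2 + b^2)) ((2:ℕ) * y^(2-1) / (y^2 + b^2)) y :=
    ((hasDerivAt_pow 2 y).add_const (b^2)).log hyb
  have h_log2 : HasDerivAt (fun y => Real.log ((y - x)^2 + a^2))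
      ((2:ℕ) * (y - x)^(2-1) * 1 / ((y - x)^2 + a^2)) y :=
    ((((hasDerivAt_id' y).sub_const x).pow 2).add_const (a^2)).log hya
  have h_atan1 : HasDerivAt (fun y => Real.arctan ((y - x) / a))
      (1 / (1 + ((y - x) / a)^2) * (1 / a)) y :=
    (((hasDerivAt_id' y).sub_const x).div_const a).arctan
  have h_atan2 : HasDerivAt (fun y => Real.arctan (y / b)) (1 / (1 + (y / b)^2) * (1 / b)) y :=
    ((hasDerivAt_id' y).div_const b).arctan
  have key := ((((h_log1.sub h_log2).const_mul x).add (h_atan1.const_mul ((x^2 - a^2 + b^2) / a))).add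
    (h_atan2.const_mul ((x^2 + a^2 - b^2) / b))).const_mul
    (a * b / ((x^2 + (a - b)^2) * (x^2 + (a + b)^2)))
  refine key.congr_deriv ?_
  have hN1 : x^2 + (a - b)^2 ≠ 0 := by positivity
  have hN2 : x^2 + (a + b)^2 ≠ 0 := by positivity
  have hxa : (x - y)^2 + a^2 ≠ 0 := by positivity
  have hA1 : 1 / (1 + ((y - x) / a)^2) * (1 / a) = a / ((y - x)^2 + a^2) := by
    field_simp; ring
  have hA2 : 1 / (1 + (y / b)^2) * (1 / b) = b / (y^2 + b^2) := by
    field_simp; ring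
  rw [hA1, hA2]
  unfold cauchy
  simp only [Nat.cast_ofNat, pow_one, mul_one, Nat.add_one_sub_one]
  field_simp
  ring

/-- `log (y²+b²) − log ((y−x)²+a²) → 0` along any filter on which `y⁻¹ → 0` and `y ≠ 0` eventually
(used for `atTop` and `atBot`). [folklore] -/
private theorem tendsto_log_sub_log {a b x : ℝ} (ha : 0 < a) (hb : 0 < b) {l : Filter ℝ}
    (hinv : Tendsto (fun y : ℝ => y⁻¹) l (𝓝 0)) (hne : ∀ᶠ y in l, y ≠ 0) :
    Tendsto (fun y => Real.log (y^2 + b^2) - Real.log ((y - x)^2 + a^2)) l (𝓝 0) := by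
  -- `g t = (1 + b² t²)/((1 - x t)² + a² t²)` is continuous with `g 0 = 1`, and the log-difference is
  -- `log (g y⁻¹)` for `y ≠ 0`.
  set g : ℝ → ℝ := fun t => (1 + b^2 * t^2) / ((1 - x * t)^2 + a^2 * t^2) with hg_def
  have hden : ∀ t : ℝ, 0 < (1 - x * t)^2 + a^2 * t^2 := by
    intro t
    rcases eq_or_ne t 0 with rfl | ht
    · norm_num
    · have : 0 < a^2 * t^2 := by positivity
      nlinarith [sq_nonneg (1 - x * t)]
  have hg_cont : Continuous g :=
    Continuous.div (by fun_prop) (by fun_prop) fun t => (hden t).ne'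
  have hg0 : g 0 = 1 := by simp [hg_def]
  have h1 : Tendsto (fun y => g y⁻¹) l (𝓝 1) := by
    have := (hg_cont.tendsto 0).comp hinv
    rwa [hg0] at this
  have h2 : Tendsto (fun y => Real.log (g y⁻¹)) l (𝓝 0) := by
    have := ((Real.continuousAt_log one_ne_zero).tendsto.comp h1)
    rwa [Function.comp_def, Real.log_one] at this
  refine h2.congr' (hne.mono fun y hy => ?_)
  show Real.log (g y⁻¹) = Real.log (y^2 + b^2) - Real.log ((y - x)^2 + a^2)
  have hyb : 0 < y^2 + b^2 := by positivity
  have hya : 0 < (y - x)^2 + a^2 := by positivity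
  rw [← Real.log_div hyb.ne' hya.ne']
  congr 1
  simp only [hg_def]
  field_simp

/-- limit of the antiderivative at `+∞`. [folklore] -/
private theorem tendsto_cauchyConvPrim_atTop {a b : ℝ} (ha : 0 < a) (hb : 0 < b) (x : ℝ) :
    Tendsto (cauchyConvPrim a b x) atTop (𝓝 (a * b / ((x^2 + (a - b)^2) * (x^2 + (a + b)^2)) *
      (x * 0 + (x^2 - a^2 + b^2) / a * (π / 2) + (x^2 + a^2 - b^2) / b * (π / 2)))) := by
  have hL := tendsto_log_sub_log (x := x) ha hb tendsto_inv_atTop_zero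
    ((eventually_gt_atTop 0).mono fun y hy => hy.ne')
  have hat1 : Tendsto (fun y : ℝ => Real.arctan ((y - x) / a)) atTop (𝓝 (π / 2)) := by
    have h : Tendsto (fun y : ℝ => (y - x) / a) atTop atTop := by
      refine Tendsto.atTop_div_const ha ?_
      simpa [sub_eq_add_neg] using tendsto_atTop_add_const_right atTop (-x) tendsto_id
    exact (Real.tendsto_arctan_atTop.mono_right nhdsWithin_le_nhds).comp h
  have hat2 : Tendsto (fun y : ℝ => Real.arctan (y / b)) atTop (𝓝 (π / 2)) :=
    (Real.tendsto_arctan_atTop.mono_right nhdsWithin_le_nhds).comp (tendsto_id.atTop_div_const hb)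
  exact (((hL.const_mul x).add (hat1.const_mul _)).add (hat2.const_mul _)).const_mul _

/-- limit of the antiderivative at `-∞`. [folklore] -/
private theorem tendsto_cauchyConvPrim_atBot {a b : ℝ} (ha : 0 < a) (hb : 0 < b) (x : ℝ) :
    Tendsto (cauchyConvPrim a b x) atBot (𝓝 (a * b / ((x^2 + (a - b)^2) * (x^2 + (a + b)^2)) *
      (x * 0 + (x^2 - a^2 + b^2) / a * (-(π / 2)) + (x^2 + a^2 - b^2) / b * (-(π / 2))))) := by
  have hL := tendsto_log_sub_log (x := x) ha hb tendsto_inv_atBot_zero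
    ((eventually_lt_atBot 0).mono fun y hy => hy.ne)
  have hat1 : Tendsto (fun y : ℝ => Real.arctan ((y - x) / a)) atBot (𝓝 (-(π / 2))) := by
    have h : Tendsto (fun y : ℝ => (y - x) / a) atBot atBot := by
      refine Tendsto.atBot_div_const ha ?_
      simpa [sub_eq_add_neg] using tendsto_atBot_add_const_right atBot (-x) tendsto_id
    exact (Real.tendsto_arctan_atBot.mono_right nhdsWithin_le_nhds).comp h
  have hat2 : Tendsto (fun y : ℝ => Real.arctan (y / b)) atBot (𝓝 (-(π / 2))) :=
    (Real.tendsto_arctan_atBot.mono_right nhdsWithin_le_nhds).comp (tendsto_id.atBot_div_const hb)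
  exact (((hL.const_mul x).add (hat1.const_mul _)).add (hat2.const_mul _)).const_mul _

/-! ## T10 -/

/-- the semigroup identity off the degenerate line `x = 0` (FTC on `ℝ`). [folklore] -/
theorem cauchy_conv_of_ne_zero {a b x : ℝ} (ha : 0 < a) (hb : 0 < b) (hx : x ≠ 0) :
    ∫ y, cauchy a (x - y) * cauchy b y = π * cauchy (a + b) x := by
  rw [integral_of_hasDerivAt_of_tendsto (hasDerivAt_cauchyConvPrim ha hb hx)
    (integrable_cauchy_conv ha hb x) (tendsto_cauchyConvPrim_atBot ha hb x)
    (tendsto_cauchyConvPrim_atTop ha hb x)]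
  unfold cauchy
  have hN1 : x^2 + (a - b)^2 ≠ 0 := by positivity
  have hN2 : x^2 + (a + b)^2 ≠ 0 := by positivity
  field_simp
  ring

/-- the convolution `x ↦ ∫ cauchy a (x - y) · cauchy b y dy` is continuous (dominated convergence,
bound `a⁻¹ · cauchy b`). [folklore] -/
theorem continuous_cauchy_conv {a b : ℝ} (ha : 0 < a) (hb : 0 < b) :
    Continuous fun x => ∫ y, cauchy a (x - y) * cauchy b y := by
  refine continuous_of_dominated (bound := fun y => a⁻¹ * cauchy b y) (fun x => ?_) (fun x => ?_) ?_ ?_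
  · exact (integrable_cauchy_conv ha hb x).aestronglyMeasurable
  · refine Eventually.of_forall fun y => ?_
    rw [Real.norm_of_nonneg (mul_nonneg (cauchy_nonneg ha _) (cauchy_nonneg hb _))]
    exact mul_le_mul_of_nonneg_right (cauchy_le_inv ha _) (cauchy_nonneg hb _)
  · exact (integrable_cauchy hb).const_mul _
  · refine Eventually.of_forall fun y => ?_
    exact ((continuous_cauchy ha).comp (continuous_id.sub continuous_const)).mul continuous_const

/-- **T10 `CauchySemigroup`** (THEORY-R4 §2): `cauchy_a ∗ cauchy_b = π · cauchy_{a+b}` for `a, b > 0`.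
[folklore] -/
theorem CauchySemigroup_holds : CauchySemigroup := by
  intro a b x ha hb
  have hab : 0 < a + b := by linarith
  have heq : (fun x => ∫ y, cauchy a (x - y) * cauchy b y) = fun x => π * cauchy (a + b) x :=
    Continuous.ext_on (dense_compl_singleton 0) (continuous_cauchy_conv ha hb)
      (continuous_const.mul (continuous_cauchy hab)) fun x hx => cauchy_conv_of_ne_zero ha hb hx
  exact congrFun heq x

/-! ## T11: factorisation of the smeared probe kernel through the descent kernel -/

/-- the `(c-1)`-Cauchy kernel smeared by the biweight of half-width `κ` and offset `u`: the `η = 1`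
near-pole half of `probeKernel`. (verbatim `DbnTheory4.smearedCauchy`, THEORY-R4 §2) -/
def smearedCauchy (c κ u x : ℝ) : ℝ :=
  ∫ v in (-1:ℝ)..1, biweight v * ((c - 1) / ((c - 1)^2 + (x - u - κ * v)^2))

/-- T11 (RH-FREE, support-grade) — interior factorisation of the smeared probe kernel through the descent
kernel: `S(·,η) = (1/2π) · smearedCauchy ∗ P(·,η)` for `|η| < 1` (semigroup `(c−1) + (1∓η) = c∓η`, Fubini).
(verbatim `DbnTheory4.ProbeKernelFactorisation`, THEORY-R4 §2) -/
def ProbeKernelFactorisation : Prop :=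
  ∀ c κ u ξ η : ℝ, 1 < c → |η| < 1 →
    probeKernel c κ u ξ η = (1 / (2 * π)) * ∫ s, smearedCauchy c κ u (ξ - s) * descentKernel s η

/-- T11, boundary form (RH-FREE, support-grade) — on `η = 1` the descent kernel is `2π·δ₀ + 4/(ξ²+4)`:
`S(·,1) = smearedCauchy + (1/2π) · smearedCauchy ∗ 4/(·²+4)`.
(verbatim `DbnTheory4.ProbeKernelBoundaryFactorisation`, THEORY-R4 §2) -/
def ProbeKernelBoundaryFactorisation : Prop :=
  ∀ c κ u ξ : ℝ, 1 < c →
    probeKernel c κ u ξ 1 = smearedCauchy c κ u ξ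
      + (1 / (2 * π)) * ∫ s, smearedCauchy c κ u (ξ - s) * (4 / (s^2 + 4))

section smeared

variable {a b : ℝ} (κ u ξ : ℝ)

/-- T10, translated: `∫ cauchy a (ξ - s - u - κv) · cauchy b s ds = π · cauchy (a+b) (ξ - u - κv)`. [folklore] -/
theorem cauchy_conv_shift (ha : 0 < a) (hb : 0 < b) (v : ℝ) :
    ∫ s, cauchy a (ξ - s - u - κ * v) * cauchy b s = π * cauchy (a + b) (ξ - u - κ * v) := by
  have h : (fun s => cauchy a (ξ - s - u - κ * v) * cauchy b s)
      = fun s => cauchy a (ξ - u - κ * v - s) * cauchy b s := by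
    funext s; rw [show ξ - s - u - κ * v = ξ - u - κ * v - s by ring]
  rw [h]
  exact CauchySemigroup_holds a b _ ha hb

/-- joint integrability of `(s, v) ↦ φ(v) · cauchy a (ξ - s - u - κv) · cauchy b s` on `ℝ × (-1,1]`. [folklore] -/
theorem integrable_smeared_prod (ha : 0 < a) (hb : 0 < b) :
    Integrable (fun p : ℝ × ℝ => biweight p.2 * (cauchy a (ξ - p.1 - u - κ * p.2) * cauchy b p.1))
      ((volume : Measure ℝ).prod (volume.restrict (Ioc (-1:ℝ) 1))) := by
  have hcont : Continuous (fun p : ℝ × ℝ =>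
      biweight p.2 * (cauchy a (ξ - p.1 - u - κ * p.2) * cauchy b p.1)) := by
    refine (continuous_biweight.comp continuous_snd).mul (Continuous.mul ?_ ?_)
    · exact (continuous_cauchy ha).comp (by fun_prop)
    · exact (continuous_cauchy hb).comp continuous_fst
  rw [integrable_prod_iff' hcont.aestronglyMeasurable]
  have hsec : ∀ v : ℝ, Integrable (fun s : ℝ => biweight v * (cauchy a (ξ - s - u - κ * v) * cauchy b s)) := by
    intro v
    have h : (fun s => cauchy a (ξ - s - u - κ * v) * cauchy b s)
        = fun s => cauchy a (ξ - u - κ * v - s) * cauchy b s := by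
      funext s; rw [show ξ - s - u - κ * v = ξ - u - κ * v - s by ring]
    have hi : Integrable (fun s => cauchy a (ξ - s - u - κ * v) * cauchy b s) := by
      rw [h]; exact integrable_cauchy_conv ha hb _
    exact hi.const_mul _
  refine ⟨Eventually.of_forall hsec, ?_⟩
  have hab : 0 < a + b := by linarith
  have h : (fun v : ℝ => ∫ s : ℝ, ‖biweight v * (cauchy a (ξ - s - u - κ * v) * cauchy b s)‖)
      = fun v => biweight v * (π * cauchy (a + b) (ξ - u - κ * v)) := by
    funext v
    rw [← cauchy_conv_shift κ u ξ ha hb v, ← integral_const_mul]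
    congr 1; funext s
    rw [Real.norm_of_nonneg]
    have := biweight_nonneg v
    have := cauchy_nonneg ha (ξ - s - u - κ * v)
    have := cauchy_nonneg hb s
    positivity
  rw [h]
  exact ((continuous_biweight.mul (continuous_const.mul
    ((continuous_cauchy hab).comp (by fun_prop)))).integrableOn_Icc).mono_set Ioc_subset_Icc_self

end smeared

section factorisation

variable {c b : ℝ} (κ u ξ : ℝ)

/-- the smeared-Cauchy convolution integrand, pointwise: `smearedCauchy (ξ - s) · cauchy b s` is the
`v`-integral of `φ(v) · cauchy (c-1) (ξ - s - u - κv) · cauchy b s`. [folklore] -/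
theorem smearedCauchy_mul_cauchy (s : ℝ) :
    smearedCauchy c κ u (ξ - s) * cauchy b s
      = ∫ v in Ioc (-1:ℝ) 1, biweight v * (cauchy (c - 1) (ξ - s - u - κ * v) * cauchy b s) := by
  rw [smearedCauchy, intervalIntegral.integral_of_le (by norm_num), ← integral_mul_const]
  congr 1; funext v
  simp only [cauchy]
  ring

/-- `s ↦ smearedCauchy (ξ - s) · cauchy b s` is integrable (`c > 1`, `b > 0`). [folklore] -/
theorem integrable_smearedCauchy_mul (hc : 1 < c) (hb : 0 < b) :
    Integrable fun s => smearedCauchy c κ u (ξ - s) * cauchy b s := by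
  have ha : 0 < c - 1 := by linarith
  refine ((integrable_smeared_prod κ u ξ ha hb).integral_prod_left).congr
    (Eventually.of_forall fun s => ?_)
  exact (smearedCauchy_mul_cauchy κ u ξ s).symm

/-- **smeared semigroup**: `∫ smearedCauchy (ξ - s) · cauchy b s ds = π ∫ φ(v) cauchy (c-1+b) (ξ-u-κv) dv`
(Fubini + T10). [folklore] -/
theorem smearedCauchy_conv (hc : 1 < c) (hb : 0 < b) :
    ∫ s, smearedCauchy c κ u (ξ - s) * cauchy b s
      = π * ∫ v in (-1:ℝ)..1, biweight v * cauchy (c - 1 + b) (ξ - u - κ * v) := by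
  have ha : 0 < c - 1 := by linarith
  have hF := integrable_smeared_prod κ u ξ ha hb
  calc ∫ s, smearedCauchy c κ u (ξ - s) * cauchy b s
      = ∫ s, ∫ v in Ioc (-1:ℝ) 1, biweight v * (cauchy (c - 1) (ξ - s - u - κ * v) * cauchy b s) := by
        congr 1; funext s; exact smearedCauchy_mul_cauchy κ u ξ s
    _ = ∫ v in Ioc (-1:ℝ) 1, ∫ s, biweight v * (cauchy (c - 1) (ξ - s - u - κ * v) * cauchy b s) :=
        integral_integral_swap hF
    _ = ∫ v in Ioc (-1:ℝ) 1, biweight v * (π * cauchy (c - 1 + b) (ξ - u - κ * v)) := by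
        congr 1; funext v
        rw [integral_const_mul, cauchy_conv_shift κ u ξ ha hb]
    _ = π * ∫ v in (-1:ℝ)..1, biweight v * cauchy (c - 1 + b) (ξ - u - κ * v) := by
        rw [intervalIntegral.integral_of_le (by norm_num), ← integral_const_mul]
        congr 1; funext v; ring

/-- interval integrability of `v ↦ φ(v) · cauchy a (ξ - u - κv)`. [folklore] -/
theorem intervalIntegrable_biweight_cauchy {a : ℝ} (ha : 0 < a) :
    IntervalIntegrable (fun v => biweight v * cauchy a (ξ - u - κ * v)) volume (-1) 1 :=
  (continuous_biweight.mul ((continuous_cauchy ha).comp (by fun_prop))).intervalIntegrable _ _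

end factorisation

/-- **T11 `ProbeKernelFactorisation`** (THEORY-R4 §2): for `c > 1`, `|η| < 1`,
`S_{c,κ,u}(ξ,η) = (1/2π) ∫ smearedCauchy_{c,κ,u}(ξ - s) · P(s,η) ds`. [folklore] -/
theorem ProbeKernelFactorisation_holds : ProbeKernelFactorisation := by
  intro c κ u ξ η hc hη
  obtain ⟨hη1, hη2⟩ := abs_lt.mp hη
  have h1 : 0 < 1 - η := by linarith
  have h2 : 0 < 1 + η := by linarith
  have hD : ∀ s, smearedCauchy c κ u (ξ - s) * descentKernel s η
      = 2 * (smearedCauchy c κ u (ξ - s) * cauchy (1 - η) s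
          + smearedCauchy c κ u (ξ - s) * cauchy (1 + η) s) := by
    intro s; simp only [descentKernel, cauchy]; ring
  simp_rw [hD]
  rw [integral_const_mul, integral_add (integrable_smearedCauchy_mul κ u ξ hc h1)
    (integrable_smearedCauchy_mul κ u ξ hc h2), smearedCauchy_conv κ u ξ hc h1,
    smearedCauchy_conv κ u ξ hc h2]
  have hc1 : 0 < c - 1 + (1 - η) := by linarith
  have hc2 : 0 < c - 1 + (1 + η) := by linarith
  rw [show (1 / (2 * π)) * (2 * (π * (∫ v in (-1:ℝ)..1, biweight v * cauchy (c - 1 + (1 - η)) (ξ - u - κ * v))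
      + π * (∫ v in (-1:ℝ)..1, biweight v * cauchy (c - 1 + (1 + η)) (ξ - u - κ * v))))
      = (∫ v in (-1:ℝ)..1, biweight v * cauchy (c - 1 + (1 - η)) (ξ - u - κ * v))
        + ∫ v in (-1:ℝ)..1, biweight v * cauchy (c - 1 + (1 + η)) (ξ - u - κ * v) by
    field_simp]
  rw [← intervalIntegral.integral_add (intervalIntegrable_biweight_cauchy κ u ξ hc1)
    (intervalIntegrable_biweight_cauchy κ u ξ hc2), probeKernel]
  congr 1; funext v
  simp only [cauchy]
  ring

/-- **T11, boundary form `ProbeKernelBoundaryFactorisation`** (THEORY-R4 §2): for `c > 1`,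
`S_{c,κ,u}(ξ,1) = smearedCauchy(ξ) + (1/2π) ∫ smearedCauchy(ξ - s) · 4/(s²+4) ds`. [folklore] -/
theorem ProbeKernelBoundaryFactorisation_holds : ProbeKernelBoundaryFactorisation := by
  intro c κ u ξ hc
  have h2 : (0:ℝ) < 2 := by norm_num
  have hD : ∀ s : ℝ, smearedCauchy c κ u (ξ - s) * (4 / (s^2 + 4))
      = 2 * (smearedCauchy c κ u (ξ - s) * cauchy 2 s) := by
    intro s; simp only [cauchy]; ring
  simp_rw [hD]
  rw [integral_const_mul, smearedCauchy_conv κ u ξ hc h2]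
  have hc1 : 0 < c - 1 := by linarith
  have hc2 : 0 < c - 1 + 2 := by linarith
  rw [show (1 / (2 * π)) * (2 * (π * ∫ v in (-1:ℝ)..1, biweight v * cauchy (c - 1 + 2) (ξ - u - κ * v)))
      = ∫ v in (-1:ℝ)..1, biweight v * cauchy (c - 1 + 2) (ξ - u - κ * v) by field_simp]
  have hS : smearedCauchy c κ u ξ = ∫ v in (-1:ℝ)..1, biweight v * cauchy (c - 1) (ξ - u - κ * v) := by
    rw [smearedCauchy]; congr 1; funext v; simp only [cauchy]; ring
  rw [hS, ← intervalIntegral.integral_add (intervalIntegrable_biweight_cauchy κ u ξ hc1)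
    (intervalIntegrable_biweight_cauchy κ u ξ hc2), probeKernel]
  congr 1; funext v
  simp only [cauchy]
  ring

end Summit.RiemannHypothesis.RiemannHypothesis.Theorems.DbnTheory

end
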